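import Literature.MathematicalPhysics.QuantumFieldTheory.Balaban1983to89.T4GenFunBounds
import Literature.Analysis.Complex.TwoConstantsDisc

/-!
# YM-DAG node N19 (= NE7 proper) — THE EXPECTATION CURRENCY OF THE NODE's DECL TARGET, III: TWO CONSTANTS (analysis half) — the derivative at the
# centre of a disc from a bound `M` on the disc and a bound `m` on its REAL DIAMETER costs `‖f′(0)‖ ≤ 2e·m·(1 + log⁺(M∕m))∕R`; hence two probability
# laws whose cumulant generating functions are `ε`-close on a real segment `|t| < l₀` have means `4·e^{1+l₀B}·ε·(1 + log⁺ ε⁻¹)∕l₀`-close — the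
# LINEAR-LOG price, in place of the sibling's Landau price `2ε∕l₀ + √(2ε)·B`

Cell `pub-ymgap`, HUMAN RULING D-0062 (Track A), R141 (C) wider-strategy seat `pub-ymgap-dag-n19-e` (strategy s3 = ALTERNATIVE CURRENCY), fifth module of
the seat; successor of `Summits/…/Theorems/BalabanUVNodesN19ExpectationCurrency.lean` (Landau's inequality, price √, p477102) and `…ExpectationCurrencyAtScheme`
(p477267), whose header left exactly this item open («a linear observable rate from `Target` alone would need complex-variable input, NOT attempted»).  The
scheme-level half (N19's DECL target `T4CauchySum.MatchingModConstants` ∕ `Spine.NE7.Target` ⇒ `ExpectCauchyRate S (δ·(1 + log⁺ δ⁻¹))`, the rate to the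
limit, which remainders pay) is the sibling `…Theorems.BalabanUVNodesN19ExpectationCurrencyTwoConstantsAtScheme`, filed right after this one (400-line rule).
Route `Summits/QuantumFields/YangMills/Theses/BalabanUVNodes.lean` rev 15, cluster item K3′ «SpineGivenEndpointR12» (stmt-QuantumFields-19908); filed
`--supports` that item `--as helper` (it proves no registered stub).  COUNT-NEUTRAL: elementary complex analysis over Mathlib and the tree's two-constants
theorem (`Literature.Analysis.Complex.TwoConstantsDisc`, [Ransford1995] Thm. 4.3.7 there, cited BY NAME) + Mathlib's moment-generating-function calculus through
the tree's `T4GenFunBounds` §3 (BY NAME); no scheme object, no Theses import; NOT a discharge claim.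

THE MECHANISM (why N19's REAL-segment hypothesis suffices and nothing is complexified).  For two a.e.-bounded observables `|X|, |Y| ≤ B` on two probability
spaces the difference of the COMPLEX moment generating functions `f = complexMGF Y ν − complexMGF X μ` is ENTIRE (`T4GenFunBounds.differentiable_complexMGF_of_abs_le`),
bounded by `M = 2e^{l₀B}` on the closed disc `|z| ≤ l₀` (`norm_complexMGF_le_of_abs_le`), and — this is where a REAL-segment matching enters — bounded by
`m = 2ε·e^{l₀B}` on the real DIAMETER when the cgf's are `ε`-close there (mgf ratio in `[e^{−ε}, e^{ε}]`).  The two-constants theorem disc ∕ diameter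
(Nevanlinna–Ostrowski, exponent explicit; tree `TwoConstantsDisc.norm_le_two_constants_disc_of_norm_le`, proved there from Mathlib's Hadamard three lines) gives
`‖f‖ ≤ m^{1−λ(r)}·M^{λ(r)}` on `|z| ≤ r·l₀`, `λ(r) = (2∕π)·arctan(2r∕(1−r²))`; Cauchy's estimate (Mathlib `Complex.norm_deriv_le_of_forall_mem_sphere_norm_le`) gives
`|∫Y dν − ∫X dμ| = ‖f′(0)‖ ≤ m^{1−λ}M^{λ}∕(r·l₀)`; and `λ(r) ≤ 2r` on `r ≤ ½` with the choice `r = 1∕(2·log(M∕m))` yields `‖f′(0)‖ ≤ 2e·m·(1 + log⁺(M∕m))∕l₀` (the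
Markov–Bernstein logarithm; for the disc ∕ diameter class the one-step `log` is not removable — Chebyshev polynomials `η·T_n`, `|T_n| ≤ (1+√2)^n` on the disc,
`T_n′(0) = ±n` —; prose, not typed, not needed).

WHAT IS KERNEL-CHECKED (0 `def`, 0 `sorry`).
* §1 [folklore] complex analysis, values in a complex Banach space: `norm_deriv_le_two_constants` (the r-form on a disc of radius `R`) ·
  `twoConstants_exponent_le_two_mul` (`(2∕π)·arctan(2r∕(1−r²)) ≤ 2r` for `0 ≤ r ≤ ½`, `Real.le_tan`, `π > 3`) · `norm_deriv_le_linlog_of_le` (`0 ≤ m ≤ M`: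
  `‖f′(0)‖ ≤ 2e·m·(1 + log(M∕m))∕R`) · `norm_deriv_le_linlog` (`0 ≤ m`, any disc bound `M`: `‖f′(0)‖ ≤ 2e·m·(1 + log⁺(M∕m))∕R`).
* §2 [folklore] mgf level, two probability spaces, `|X|, |Y| ≤ B` a.e.: `norm_complexMGF_sub_complexMGF_le` (`≤ 2e^{‖z‖B}`) · `abs_mgf_sub_mgf_le_of_cgf_close`
  (`|cgf_Y(t) − cgf_X(t)| ≤ ε ⇒ |mgf_Y(t) − mgf_X(t)| ≤ 2ε·e^{|t|B}`, EVERY `ε ≥ 0`, `Real.abs_exp_sub_one_le`) · `abs_integral_sub_integral_le_linlog_of_cgf_close`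
  (cgf's `ε`-close on `|t| < l₀`, `0 < l₀`, `0 ≤ ε` ⇒ `|∫Y dν − ∫X dμ| ≤ 4·e^{1+l₀B}·ε·(1 + log⁺ ε⁻¹)∕l₀`; the derivative at `0` is the difference of the means
  by `T4GenFunBounds.iteratedDeriv_complexMGF_zero_of_abs_le`).

HONEST FRAMING.  Pure analysis ∕ probability bookkeeping; no statement of [Balaban1987RG1]–[Balaban1989LargeFieldII] or [King1986] is asserted, quoted or
instantiated; NE7 is NOT PRINTED and NOT PROVED and does not even occur in this half; N19 is NOT discharged; K3′ is NOT claimed; Track A count unmoved (typed 28∕28 ·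
discharged 5∕27 · A 5∕28).  One finite four-torus at fixed ε is the only context (through the sibling) — NOT infinite volume, NOT OS on ℝ⁴, NOT a mass gap, NOT
Clay.  THEOREMS ONLY; 0 sorry; standard axioms.  No decl below carries a cite tag (the two-constants theorem is the tree's and is used by name).
-/

set_option autoImplicit false

noncomputable section

open Set Metric Filter Topology MeasureTheory ProbabilityTheory Complex
open scoped BigOperators

namespace Summit.QuantumFields.YangMills.BalabanUVNodes.N19ExpectationCurrencyTwoConstants

open Literature.MathematicalPhysics.QuantumFieldTheory.Balaban1983to89
open Literature.Analysis.Complex.TwoConstantsDisc (norm_le_two_constants_disc_of_norm_le)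

/-! ## §1 Complex analysis: the derivative at the centre from two constants [folklore] -/

section Complex

variable {E : Type*} [NormedAddCommGroup E] [NormedSpace ℂ E]

/-- **Derivative at the centre from two constants, r-form.**  `f` holomorphic in the open disc `|z| < R` and continuous on the closed disc,
`‖f‖ ≤ M` on `|z| ≤ R`, `‖f(x)‖ ≤ m` for real `|x| < R`, `0 ≤ m ≤ M`; then for every `0 < r < 1`
`‖f′(0)‖ ≤ m^{1−λ(r)}·M^{λ(r)}∕(r·R)`, `λ(r) = (2∕π)·arctan(2r∕(1−r²))` — the tree's two-constants theorem (disc ∕ diameter) on `|z| ≤ r·R`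
followed by Cauchy's estimate on the circle `|z| = r·R`. [folklore] -/
theorem norm_deriv_le_two_constants {f : ℂ → E} {m M R r : ℝ} (hR : 0 < R) (hf : DiffContOnCl ℂ f (ball 0 R))
    (hM : ∀ z : ℂ, ‖z‖ ≤ R → ‖f z‖ ≤ M) (hm : ∀ x : ℝ, |x| < R → ‖f x‖ ≤ m) (hm0 : 0 ≤ m) (hmM : m ≤ M)
    (hr0 : 0 < r) (hr1 : r < 1) :
    ‖deriv f 0‖ ≤ m ^ (1 - 2 / Real.pi * Real.arctan (2 * r / (1 - r ^ 2))) *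
      M ^ (2 / Real.pi * Real.arctan (2 * r / (1 - r ^ 2))) / (r * R) := by
  set l : ℝ := 2 / Real.pi * Real.arctan (2 * r / (1 - r ^ 2)) with hl
  -- rescale to the unit disc
  set g : ℂ → E := fun z => f ((R : ℂ) * z) with hg
  have hRn : ∀ z : ℂ, ‖(R : ℂ) * z‖ = R * ‖z‖ := fun z => by
    rw [norm_mul, Complex.norm_real, Real.norm_eq_abs, abs_of_pos hR]
  have hmaps : MapsTo (fun z : ℂ => (R : ℂ) * z) (ball (0 : ℂ) 1) (ball (0 : ℂ) R) := fun z hz => by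
    rw [mem_ball_zero_iff] at hz ⊢
    rw [hRn]
    nlinarith
  have hgd : DiffContOnCl ℂ g (ball 0 1) :=
    hf.comp ((differentiable_id.const_mul (R : ℂ)).diffContOnCl) hmaps
  have hMg : ∀ z : ℂ, ‖z‖ ≤ 1 → ‖g z‖ ≤ M := fun z hz =>
    hM _ (by rw [hRn]; nlinarith)
  have hmg : ∀ x : ℝ, |x| < 1 → ‖g x‖ ≤ m := fun x hx => by
    have e : (R : ℂ) * (x : ℂ) = ((R * x : ℝ) : ℂ) := by push_cast; ring
    show ‖f ((R : ℂ) * (x : ℂ))‖ ≤ m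
    rw [e]
    refine hm (R * x) ?_
    rw [abs_mul, abs_of_pos hR]
    nlinarith
  -- two constants on `|z| ≤ r`, then Cauchy's estimate on the circle `|z| = r`
  have hC : ∀ z ∈ sphere (0 : ℂ) r, ‖g z‖ ≤ m ^ (1 - l) * M ^ l := fun z hz =>
    norm_le_two_constants_disc_of_norm_le hgd hMg hmg hm0 hmM hr1 (mem_sphere_zero_iff_norm.1 hz).le
  have hgr : DiffContOnCl ℂ g (ball 0 r) := by
    refine DifferentiableOn.diffContOnCl ?_
    rw [closure_ball (0 : ℂ) hr0.ne']
    exact hgd.differentiableOn.mono (closedBall_subset_ball hr1)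
  have key := Complex.norm_deriv_le_of_forall_mem_sphere_norm_le hr0 hgr hC
  have hderiv : deriv g 0 = (R : ℂ) • deriv f 0 := by
    have h := deriv_comp_mul_left (R : ℂ) f 0
    rw [mul_zero] at h
    exact h
  rw [hderiv, norm_smul, Complex.norm_real, Real.norm_eq_abs, abs_of_pos hR] at key
  rw [le_div_iff₀ (mul_pos hr0 hR)]
  calc ‖deriv f 0‖ * (r * R) = R * ‖deriv f 0‖ * r := by ring
    _ ≤ m ^ (1 - l) * M ^ l / r * r := mul_le_mul_of_nonneg_right key hr0.le
    _ = m ^ (1 - l) * M ^ l := div_mul_cancel₀ _ hr0.ne'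

/-- The two-constants exponent is at most `2r` on `0 ≤ r ≤ ½`: `(2∕π)·arctan(2r∕(1−r²)) ≤ (2∕π)·(8r∕3) ≤ 2r` (`arctan y ≤ y` for `y ≥ 0` by
`Real.le_tan`, and `π ≥ 3`). [folklore] -/
theorem twoConstants_exponent_le_two_mul {r : ℝ} (hr0 : 0 ≤ r) (hr : r ≤ 1 / 2) :
    2 / Real.pi * Real.arctan (2 * r / (1 - r ^ 2)) ≤ 2 * r := by
  have hπ : 3 < Real.pi := Real.pi_gt_three
  have hden : 3 / 4 ≤ 1 - r ^ 2 := by nlinarith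
  have hy0 : 0 ≤ 2 * r / (1 - r ^ 2) := div_nonneg (by linarith) (by linarith)
  -- `arctan y ≤ y`
  have hat : Real.arctan (2 * r / (1 - r ^ 2)) ≤ 2 * r / (1 - r ^ 2) := by
    set y := 2 * r / (1 - r ^ 2)
    have ha0 : 0 ≤ Real.arctan y := by
      rw [← Real.arctan_zero]; exact Real.arctan_strictMono.monotone hy0
    have h := Real.le_tan ha0 (Real.arctan_lt_pi_div_two y)
    rwa [Real.tan_arctan] at h
  have hy : 2 * r / (1 - r ^ 2) ≤ 8 * r / 3 := by
    rw [div_le_div_iff₀ (by linarith) (by norm_num)]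
    nlinarith
  calc 2 / Real.pi * Real.arctan (2 * r / (1 - r ^ 2)) ≤ 2 / Real.pi * (8 * r / 3) :=
        mul_le_mul_of_nonneg_left (hat.trans hy) (by positivity)
    _ = 16 * r / (3 * Real.pi) := by ring
    _ ≤ 2 * r := by
        rw [div_le_iff₀ (by positivity)]
        nlinarith

/-- **Derivative at the centre from two constants, LINEAR-LOG form** (`0 ≤ m ≤ M`): `‖f′(0)‖ ≤ 2e·m·(1 + log(M∕m))∕R`.  Choice of the radius in the
r-form: `r = ½` if `log(M∕m) ≤ 1`, else `r = 1∕(2·log(M∕m))`, where `(M∕m)^{λ(r)} ≤ (M∕m)^{2r} = e`. [folklore] -/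
theorem norm_deriv_le_linlog_of_le {f : ℂ → E} {m M R : ℝ} (hR : 0 < R) (hf : DiffContOnCl ℂ f (ball 0 R))
    (hM : ∀ z : ℂ, ‖z‖ ≤ R → ‖f z‖ ≤ M) (hm : ∀ x : ℝ, |x| < R → ‖f x‖ ≤ m) (hm0 : 0 ≤ m) (hmM : m ≤ M) :
    ‖deriv f 0‖ ≤ 2 * Real.exp 1 * m * (1 + Real.log (M / m)) / R := by
  -- the r-form at a radius `r ∈ (0, ½]`, rewritten as `m·(M/m)^{λ(r)}/(rR)`
  have main : ∀ r : ℝ, 0 < r → r ≤ 1 / 2 →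
      ‖deriv f 0‖ ≤ m * (M / m) ^ (2 / Real.pi * Real.arctan (2 * r / (1 - r ^ 2))) / (r * R) := by
    intro r hr0 hr
    have h := norm_deriv_le_two_constants hR hf hM hm hm0 hmM hr0 (by linarith)
    set l := 2 / Real.pi * Real.arctan (2 * r / (1 - r ^ 2)) with hl
    have hl1 : l < 1 := by
      have := Real.arctan_lt_pi_div_two (2 * r / (1 - r ^ 2))
      rw [hl, div_mul_eq_mul_div, div_lt_one Real.pi_pos]
      linarith
    rcases hm0.eq_or_lt with hm00 | hmpos
    · rw [← hm00] at h ⊢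
      rw [Real.zero_rpow (by linarith), zero_mul, zero_div] at h
      rw [zero_mul, zero_div]
      exact h
    · have hMpos : 0 < M := hmpos.trans_le hmM
      have e : m ^ (1 - l) * M ^ l = m * (M / m) ^ l := by
        rw [Real.div_rpow hMpos.le hmpos.le, Real.rpow_sub hmpos, Real.rpow_one]
        field_simp
      rwa [e] at h
  rcases hm0.eq_or_lt with hm00 | hmpos
  · -- `m = 0`
    have h := main (1 / 2) (by norm_num) le_rfl
    rw [← hm00] at h ⊢
    rw [zero_mul, zero_div] at h
    rw [mul_zero, zero_mul, zero_div]
    exact h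
  have hMpos : 0 < M := hmpos.trans_le hmM
  have hq : 1 ≤ M / m := by rwa [le_div_iff₀ hmpos, one_mul]
  set Λ := Real.log (M / m) with hΛ
  have hΛ0 : 0 ≤ Λ := Real.log_nonneg hq
  have hexpΛ : Real.exp Λ = M / m := Real.exp_log (by positivity)
  rcases le_or_gt Λ 1 with hΛ1 | hΛ1
  · -- `r = ½`: `(M/m)^{λ} ≤ (M/m)^1 = e^{Λ} ≤ e`
    have h := main (1 / 2) (by norm_num) le_rfl
    set l := 2 / Real.pi * Real.arctan (2 * (1 / 2 : ℝ) / (1 - (1 / 2 : ℝ) ^ 2)) with hl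
    have hl1 : l ≤ 1 := (twoConstants_exponent_le_two_mul (by norm_num) le_rfl).trans (by norm_num)
    have hpow : (M / m) ^ l ≤ Real.exp 1 :=
      calc (M / m) ^ l ≤ (M / m) ^ (1 : ℝ) := Real.rpow_le_rpow_of_exponent_le hq hl1
        _ = Real.exp Λ := by rw [Real.rpow_one, hexpΛ]
        _ ≤ Real.exp 1 := Real.exp_le_exp.2 hΛ1
    calc ‖deriv f 0‖ ≤ m * (M / m) ^ l / (1 / 2 * R) := h
      _ ≤ m * Real.exp 1 / (1 / 2 * R) := by gcongr
      _ = 2 * Real.exp 1 * m * 1 / R := by field_simp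
      _ ≤ 2 * Real.exp 1 * m * (1 + Λ) / R := by gcongr; linarith
  · -- `r = 1/(2Λ)`: `λ(r) ≤ 2r = 1/Λ`, `(M/m)^{1/Λ} = e`
    have hΛpos : 0 < Λ := zero_lt_one.trans hΛ1
    have hr0 : 0 < 1 / (2 * Λ) := by positivity
    have hr : 1 / (2 * Λ) ≤ 1 / 2 := by
      rw [div_le_div_iff₀ (by positivity) (by norm_num)]
      linarith
    have h := main (1 / (2 * Λ)) hr0 hr
    set l := 2 / Real.pi * Real.arctan (2 * (1 / (2 * Λ)) / (1 - (1 / (2 * Λ)) ^ 2)) with hl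
    have hl1 : l ≤ 1 / Λ := (twoConstants_exponent_le_two_mul hr0.le hr).trans (by rw [mul_one_div, div_le_div_iff₀ (by positivity) hΛpos]; linarith)
    have hpow : (M / m) ^ l ≤ Real.exp 1 :=
      calc (M / m) ^ l ≤ (M / m) ^ (1 / Λ) := Real.rpow_le_rpow_of_exponent_le hq hl1
        _ = Real.exp (Λ * (1 / Λ)) := by rw [Real.exp_mul, hexpΛ]
        _ = Real.exp 1 := by rw [mul_one_div_cancel hΛpos.ne']
    calc ‖deriv f 0‖ ≤ m * (M / m) ^ l / (1 / (2 * Λ) * R) := h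
      _ ≤ m * Real.exp 1 / (1 / (2 * Λ) * R) := by gcongr
      _ = 2 * Real.exp 1 * m * Λ / R := by field_simp
      _ ≤ 2 * Real.exp 1 * m * (1 + Λ) / R := by gcongr; linarith

/-- **Derivative at the centre from two constants, LINEAR-LOG form, any disc bound** (`0 ≤ m`): `‖f′(0)‖ ≤ 2e·m·(1 + log⁺(M∕m))∕R` (apply the
previous form with the disc bound `max M m`). [folklore] -/
theorem norm_deriv_le_linlog {f : ℂ → E} {m M R : ℝ} (hR : 0 < R) (hf : DiffContOnCl ℂ f (ball 0 R))
    (hM : ∀ z : ℂ, ‖z‖ ≤ R → ‖f z‖ ≤ M) (hm : ∀ x : ℝ, |x| < R → ‖f x‖ ≤ m) (hm0 : 0 ≤ m) :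
    ‖deriv f 0‖ ≤ 2 * Real.exp 1 * m * (1 + Real.posLog (M / m)) / R := by
  have hM' : ∀ z : ℂ, ‖z‖ ≤ R → ‖f z‖ ≤ max M m := fun z hz => (hM z hz).trans (le_max_left _ _)
  have h := norm_deriv_le_linlog_of_le hR hf hM' hm hm0 (le_max_right _ _)
  refine h.trans ?_
  have hM0 : 0 ≤ M := (norm_nonneg (f 0)).trans (hM 0 (by simpa using hR.le))
  rcases hm0.eq_or_lt with hm00 | hmpos
  · rw [← hm00]; simp
  · have e : max M m / m = max 1 (M / m) := by
      rw [← max_div_div_right hmpos.le, div_self hmpos.ne', max_comm]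
    rw [Real.posLog_eq_log_max_one (div_nonneg hM0 hmpos.le), ← e]

end Complex

/-! ## §2 Two probability spaces: close cgf's on a real segment pay the means at the linear-log price [folklore] -/

section MGF

variable {Ω Ω' : Type*} [MeasurableSpace Ω] [MeasurableSpace Ω'] {μ : Measure Ω} {ν : Measure Ω'}
  [IsProbabilityMeasure μ] [IsProbabilityMeasure ν] {X : Ω → ℝ} {Y : Ω' → ℝ} {B : ℝ}

/-- The difference of the complex moment generating functions of two a.e.-bounded observables (`|X|, |Y| ≤ B`) on two probability spaces is
bounded by `2·e^{‖z‖B}` on all of `ℂ` (`T4GenFunBounds.norm_complexMGF_le_of_abs_le`). [folklore] -/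
theorem norm_complexMGF_sub_complexMGF_le (hXB : ∀ᵐ ω ∂μ, |X ω| ≤ B) (hYB : ∀ᵐ ω ∂ν, |Y ω| ≤ B) (z : ℂ) :
    ‖complexMGF Y ν z - complexMGF X μ z‖ ≤ 2 * Real.exp (‖z‖ * B) := by
  have hX := T4GenFunBounds.norm_complexMGF_le_of_abs_le hXB z
  have hY := T4GenFunBounds.norm_complexMGF_le_of_abs_le hYB z
  rw [probReal_univ, one_mul] at hX hY
  calc ‖complexMGF Y ν z - complexMGF X μ z‖ ≤ ‖complexMGF Y ν z‖ + ‖complexMGF X μ z‖ := norm_sub_le _ _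
    _ ≤ Real.exp (‖z‖ * B) + Real.exp (‖z‖ * B) := add_le_add hY hX
    _ = 2 * Real.exp (‖z‖ * B) := by ring

/-- `ε`-close cumulant generating functions give `2ε·e^{|t|B}`-close moment generating functions (EVERY `ε ≥ 0`): `mgf_Y(t)∕mgf_X(t) = e^{s}` with
`|s| ≤ ε`, so `|mgf_Y(t) − mgf_X(t)| = mgf_X(t)·|e^{s} − 1| ≤ e^{|t|B}·2ε` when `ε ≤ 1` (`Real.abs_exp_sub_one_le`), and `≤ 2e^{|t|B} ≤ 2ε·e^{|t|B}`
otherwise. [folklore] -/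
theorem abs_mgf_sub_mgf_le_of_cgf_close (hX : AEMeasurable X μ) (hY : AEMeasurable Y ν) (hXB : ∀ᵐ ω ∂μ, |X ω| ≤ B)
    (hYB : ∀ᵐ ω ∂ν, |Y ω| ≤ B) {ε t : ℝ} (hε : |cgf Y ν t - cgf X μ t| ≤ ε) :
    |mgf Y ν t - mgf X μ t| ≤ 2 * ε * Real.exp (|t| * B) := by
  have hmX : mgf X μ t ≤ Real.exp (|t| * B) := by
    have h := T4GenFunBounds.mgf_le_of_abs_le hXB t; rwa [probReal_univ, one_mul] at h
  have hmY : mgf Y ν t ≤ Real.exp (|t| * B) := by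
    have h := T4GenFunBounds.mgf_le_of_abs_le hYB t; rwa [probReal_univ, one_mul] at h
  have hε0 : 0 ≤ ε := (abs_nonneg _).trans hε
  rcases le_or_gt ε 1 with hε1 | hε1
  · have eX : Real.exp (cgf X μ t) = mgf X μ t := exp_cgf (T4GenFunBounds.integrable_exp_mul_of_bound hX hXB t)
    have eY : Real.exp (cgf Y ν t) = mgf Y ν t := exp_cgf (T4GenFunBounds.integrable_exp_mul_of_bound hY hYB t)
    have key : mgf Y ν t - mgf X μ t = mgf X μ t * (Real.exp (cgf Y ν t - cgf X μ t) - 1) := by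
      rw [← eX, ← eY, Real.exp_sub]
      have hne : Real.exp (cgf X μ t) ≠ 0 := (Real.exp_pos _).ne'
      field_simp
    rw [key, abs_mul, abs_of_nonneg (mgf_nonneg)]
    have h1 : |Real.exp (cgf Y ν t - cgf X μ t) - 1| ≤ 2 * ε :=
      (Real.abs_exp_sub_one_le (hε.trans hε1)).trans (by linarith)
    calc mgf X μ t * |Real.exp (cgf Y ν t - cgf X μ t) - 1| ≤ Real.exp (|t| * B) * (2 * ε) :=
        mul_le_mul hmX h1 (abs_nonneg _) (Real.exp_nonneg _)
      _ = 2 * ε * Real.exp (|t| * B) := by ring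
  · calc |mgf Y ν t - mgf X μ t| ≤ |mgf Y ν t| + |mgf X μ t| := abs_sub _ _
      _ = mgf Y ν t + mgf X μ t := by rw [abs_of_nonneg mgf_nonneg, abs_of_nonneg mgf_nonneg]
      _ ≤ Real.exp (|t| * B) + Real.exp (|t| * B) := add_le_add hmY hmX
      _ = 2 * 1 * Real.exp (|t| * B) := by ring
      _ ≤ 2 * ε * Real.exp (|t| * B) := by gcongr

/-- **CLOSE CGF's ON A REAL SEGMENT PAY THE MEANS AT THE LINEAR-LOG PRICE.**  Two probability spaces, observables `|X|, |Y| ≤ B` a.e.; if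
`|cgf_Y(t) − cgf_X(t)| ≤ ε` for every real `|t| < l₀` (`0 < l₀`, `0 ≤ ε`), then
`|∫ Y dν − ∫ X dμ| ≤ 4·e^{1+l₀B}·ε·(1 + log⁺ ε⁻¹)∕l₀`
— §1's `norm_deriv_le_linlog` for the ENTIRE function `complexMGF Y ν − complexMGF X μ` (disc bound `2e^{l₀B}`, diameter bound `2ε·e^{l₀B}`), whose
derivative at `0` is the difference of the means (`T4GenFunBounds.iteratedDeriv_complexMGF_zero_of_abs_le`). [folklore] -/
theorem abs_integral_sub_integral_le_linlog_of_cgf_close (hX : AEMeasurable X μ) (hY : AEMeasurable Y ν)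
    (hXB : ∀ᵐ ω ∂μ, |X ω| ≤ B) (hYB : ∀ᵐ ω ∂ν, |Y ω| ≤ B) {ε l₀ : ℝ} (hl₀ : 0 < l₀) (hε0 : 0 ≤ ε)
    (hε : ∀ t : ℝ, |t| < l₀ → |cgf Y ν t - cgf X μ t| ≤ ε) :
    |∫ ω, Y ω ∂ν - ∫ ω, X ω ∂μ| ≤ 4 * Real.exp (1 + l₀ * B) * ε * (1 + Real.posLog ε⁻¹) / l₀ := by
  have hB0 : 0 ≤ B := T4GenFunBounds.nonneg_of_ae_abs_le (IsProbabilityMeasure.ne_zero μ) hXB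
  set f : ℂ → ℂ := fun z => complexMGF Y ν z - complexMGF X μ z with hf
  have hdY := T4GenFunBounds.differentiable_complexMGF_of_abs_le hY hYB
  have hdX := T4GenFunBounds.differentiable_complexMGF_of_abs_le hX hXB
  have hfd : Differentiable ℂ f := hdY.sub hdX
  -- disc bound
  have hM : ∀ z : ℂ, ‖z‖ ≤ l₀ → ‖f z‖ ≤ 2 * Real.exp (l₀ * B) := fun z hz =>
    (norm_complexMGF_sub_complexMGF_le hXB hYB z).trans (by gcongr)
  -- diameter bound
  have hm : ∀ x : ℝ, |x| < l₀ → ‖f x‖ ≤ 2 * ε * Real.exp (l₀ * B) := fun x hx => by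
    show ‖complexMGF Y ν x - complexMGF X μ x‖ ≤ _
    rw [complexMGF_ofReal, complexMGF_ofReal, ← Complex.ofReal_sub, Complex.norm_real, Real.norm_eq_abs]
    exact (abs_mgf_sub_mgf_le_of_cgf_close hX hY hXB hYB (hε x hx)).trans (by gcongr)
  have key := norm_deriv_le_linlog hl₀ hfd.diffContOnCl hM hm (by positivity)
  -- the derivative at `0` is the difference of the means
  have hderiv : deriv f 0 = (((∫ ω, Y ω ∂ν) - ∫ ω, X ω ∂μ : ℝ) : ℂ) := by
    have e1 : deriv f 0 = deriv (complexMGF Y ν) 0 - deriv (complexMGF X μ) 0 :=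
      deriv_sub (hdY 0) (hdX 0)
    have eY := T4GenFunBounds.iteratedDeriv_complexMGF_zero_of_abs_le hY hYB 1
    have eX := T4GenFunBounds.iteratedDeriv_complexMGF_zero_of_abs_le hX hXB 1
    rw [iteratedDeriv_one] at eY eX
    rw [e1, eY, eX, Complex.ofReal_sub]
    simp
  rw [hderiv, Complex.norm_real, Real.norm_eq_abs] at key
  refine key.trans (le_of_eq ?_)
  rcases hε0.eq_or_lt with hε00 | hεpos
  · rw [← hε00]; simp
  · have hq : 2 * Real.exp (l₀ * B) / (2 * ε * Real.exp (l₀ * B)) = ε⁻¹ := by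
      field_simp
    rw [hq, Real.exp_add]
    ring

end MGF

end Summit.QuantumFields.YangMills.BalabanUVNodes.N19ExpectationCurrencyTwoConstants

end
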